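import Summits.Parity.GeneralizedHardyLittlewood.Theorems.LeeYangFibresCellParityLawBase
import Summits.Parity.GeneralizedHardyLittlewood.Theorems.LeeYangFibresAbsoluteUpgradeAnatomyAlong
import Summits.Parity.GeneralizedHardyLittlewood.Theorems.LeeYangFibresAbsoluteUpgradeQuantClipNumerics
import HarnessLib

/-!
# Route `LeeYangFibres`, crux `CellParityLawSaving` (stmt-Parity-18104), line `superpoly-band-same-atom`:
# helpers for the registered stub `stub_baseSavInlined` (the base `t = 1` along the schedule)

`--supports` file 1/2 of the stub `stub_baseSavInlined` of the skeleton
`Cruxes/CellParityLawSaving/Lines/SketchIdeator3.lean`: the law along the schedule `u = U(N) = slowDegree N`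
for ONE affine form `ψ(n) = a n + b` with a `(log N)^{-δ}` saving. It is a port of the sister crux's landed
`stub_base : LawEffAt 1` (`LeeYangFibresCellParityLawBase.lean`, stmt-Parity-14109), in which the roughness
`u` and the cell index were fixed before the threshold `N₀` was chosen; along the schedule both move with `N`,
so every constant must be explicit in `(u, i)`. This file contains (the last three in the sub-namespace
`BaseSavAux`):

* `baseSav_cell_law_at` (registered helper) — the body of the sister's `BaseAux.cell_law` at ONE scale `N`,
  with the local law for the class counts taken as a hypothesis with an arbitrary error `E` and every
  threshold explicit:
  `|C_{i+1} − β_∞ 𝔖 a_{i+1}| ≤ R` as soon as `2L + 2 ≤ N^{1/u}` and `E + 2L ≤ R`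
  (slice `K ∩ {ψ > 0}` = an interval, `gcd(a, b) > 1` kills both sides, otherwise the values form a
  progression segment: `RoughCellsSegment.abs_card_segment_sub_le`);
* `schedule_numerics` — along the schedule the constant of the explicit local law
  (`RoughCellsLocal.abs_cellClass_segment_sub_le_explicit`, fed with `A₁^{2U+1}`, `A₃^{U+1}`) is
  `(log N)^{o(1)}`: `2 K(U) (2U+2)² ≤ exp(2U²)` for `U ≥ U₀`, via `quantClip_powSelf_le_exp`;
* `schedule_thresholds`, `budget` — the thresholds of the explicit local law along the schedule and the
  real arithmetic of the error budget `E + 2L ≤ N/(log N)^{3/2}`.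

References: K. Alladi, Quart. J. Math. Oxford (2) 33 (1982) 129–148 [Alladi1982]; G. Tenenbaum,
*Introduction to analytic and probabilistic number theory*, III.6 [Tenenbaum2015].
-/

noncomputable section

open scoped BigOperators Classical ArithmeticFunction.Omega
open Finset Filter MeasureTheory Literature.NumberTheory.Sieve
open Summit.Parity.GeneralizedHardyLittlewood.Cruxes.CellParityLaw.SectionAnnihilator
open Summit.Parity.GeneralizedHardyLittlewood.Cruxes.AbsoluteUpgrade.DipMarginRateExchange (slowDegree
  four_le_slowDegree quantClip_schedule quantClip_powSelf_le_exp)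

namespace Summit.Parity.GeneralizedHardyLittlewood.Cruxes.CellParityLawSaving.SuperPolyBand

open Summit.Parity.GeneralizedHardyLittlewood.Cruxes.CellParityLaw.SectionAnnihilator.BaseAux

/-! ## The law for one form at one scale, every constant explicit (registered helper) -/

/-- **The law for one form and one cell index at ONE scale `N`** (registered helper `baseSav_cell_law_at`
of the stub `stub_baseSavInlined`; the statement is written on one line, verbatim as registered). Let
`L ≥ 1`, `N ≥ 1`, `2L + 2 ≤ N^{1/u}`, and assume the local law for the class counts of the cell `Ω = i + 1`
of the `N^{1/u}`-rough numbers at this `N` with error `E ≥ 0` (the sixth hypothesis, the shape consumed by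
`RoughCellsSegment.abs_card_segment_sub_le`). Then for every non-degenerate one-form system `Ψ` of size
`≤ L` at scale `N` and every convex `K ⊆ [-N, N]`,
`|C_{i+1}(Ψ, K, N, u) − β_∞(Ψ, K) 𝔖(Ψ) a_{i+1}(N, u)| ≤ R` whenever `E + 2L ≤ R`
(the sister's `BaseAux.cell_law`, body verbatim, thresholds exposed: the slice `K ∩ {ψ > 0}` is an
interval, `gcd(a, b) > 1` kills both sides, otherwise the values form a progression segment). -/
theorem baseSav_cell_law_at : ∀ {L u N i : ℕ} {E R : ℝ}, 1 ≤ L → 1 ≤ N → (2 * L + 2 : ℝ) ≤ (N : ℝ) ^ ((1 : ℝ) / u) → 0 ≤ E → E + 2 * L ≤ R → (∀ q : ℕ, 0 < q → q ≤ L → ∀ r : ℕ, r.Coprime q → ∀ V₁ V₂ : ℕ, V₁ ≤ V₂ → V₂ ≤ L * N → |(#((roughIcc (⌊(N : ℝ) ^ ((1 : ℝ) / u)⌋₊ + 1) V₂).filter (fun v => Ω v = i + 1 ∧ v ≡ r [MOD q])) : ℝ) - #((roughIcc (⌊(N : ℝ) ^ ((1 : ℝ) / u)⌋₊ + 1) V₁).filter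 (fun v => Ω v = i + 1 ∧ v ≡ r [MOD q])) - ((V₂ : ℝ) - V₁) / Nat.totient q * ((#((roughIcc (⌊(N : ℝ) ^ ((1 : ℝ) / u)⌋₊ + 1) N).filter (fun v => Ω v = i + 1)) : ℝ) / N)| ≤ E) → ∀ Ψ : Fin 1 → AffLinForm 1, IsNondegenerateSystem Ψ → affLinSize Ψ N ≤ L → ∀ K : Set (Fin 1 → ℝ), Convex ℝ K → K ⊆ realBox 1 N → |(cell Ψ K N u (fun _ => i + 1) : ℝ) - archFactor Ψ K * singularProduct Ψ * modelDensity N u (i + 1)| ≤ R := by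
  intro L u N i E R hL hN hLz hE0 hER hlocN Ψ hΨ hsize K hK hKN
  -- notation and basic facts
  set a : ℤ := (Ψ 0).coeff 0 with ha
  set b : ℤ := (Ψ 0).const with hb
  set z : ℝ := (N : ℝ) ^ ((1 : ℝ) / u) with hz
  have hN0 : 0 < N := by omega
  have hN0' : (0 : ℝ) < N := by exact_mod_cast hN0
  have hL0 : (0 : ℝ) ≤ L := Nat.cast_nonneg L
  have hR0 : 0 ≤ R := by linarith
  have ha0 : a ≠ 0 := by
    intro h0
    apply hΨ.1 0
    funext k
    rw [Fin.fin_one_eq_zero k]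
    exact h0
  obtain ⟨haL, habL⟩ := coeff_bounds hN0 hsize
  have hz2 : 2 ≤ z := by linarith
  have haLR : (a.natAbs : ℝ) ≤ L := by exact_mod_cast haL
  have haz : (a.natAbs : ℝ) < z := by linarith
  -- the model density is `A/N`
  rw [modelDensity_eq_card_div (by omega : 1 ≤ i + 1)]
  set A : ℝ := (#((roughIcc (⌊z⌋₊ + 1) N).filter (fun v => Ω v = i + 1)) : ℝ) with hA
  have hA1 : A / N ≤ 1 := by
    rw [div_le_one hN0', hA]
    exact_mod_cast card_roughIcc_filter_cardFactors_le _ N (i + 1)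
  have hA0 : 0 ≤ A / N := by positivity
  -- Case 1: a local obstruction `gcd(a, b) > 1`
  by_cases hg : Int.gcd a b ≠ 1
  · have hS : singularProduct Ψ = 0 := by
      rw [OneForm.singularProduct_eq Ψ ha0, if_neg hg]
    have hg0 : Int.gcd a b ≠ 0 := fun h => ha0 (Int.gcd_eq_zero_iff.mp h).1
    have hga : Int.gcd a b ≤ a.natAbs := Nat.gcd_le_left _ (Int.natAbs_pos.mpr ha0)
    have hcell : cell Ψ K N u (fun _ => i + 1) = 0 := by
      rw [cell_eq_card_filter, ← Finset.filter_filter]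
      exact RoughCellsSegment.card_filter_Icc_eq_zero_of_dvd (g := Int.gcd a b) (by omega)
        (Int.gcd_dvd_left a b) (Int.gcd_dvd_right a b)
        (lt_of_le_of_lt (by exact_mod_cast hga) haz) hz2 _ (fun _ v => Ω v = i + 1)
    rw [hcell, hS]
    simpa using hR0
  push Not at hg
  -- Case 2: `gcd(a, b) = 1`, `𝔖 = |a|/φ(|a|)`
  have hS : singularProduct Ψ = (a.natAbs : ℝ) / Nat.totient a.natAbs := by
    rw [OneForm.singularProduct_eq Ψ ha0, if_pos hg]
  have hq0 : 0 < a.natAbs := Int.natAbs_pos.mpr ha0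
  have hφ1 : (1 : ℝ) ≤ Nat.totient a.natAbs := by exact_mod_cast Nat.totient_pos.mpr hq0
  have hqφ : (a.natAbs : ℝ) / Nat.totient a.natAbs ≤ L := (div_le_self (Nat.cast_nonneg _) hφ1).trans haLR
  have hqφ0 : 0 ≤ (a.natAbs : ℝ) / Nat.totient a.natAbs := by positivity
  -- the slice `S = K ∩ {ψ > 0}` and its integer points
  set S : Set ℝ := {r : ℝ | (fun _ : Fin 1 => r) ∈ K ∧ 0 < (a : ℝ) * r + b} with hSdef
  have hSoc : S.OrdConnected :=
    ((DimOne.convex_slice hK).inter (DimOne.convex_setOf_pos (a : ℝ) b)).ordConnected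
  have hSN : S ⊆ Set.Icc (-(N : ℝ)) N := by
    intro r hr
    have h := hKN hr.1
    simp only [realBox, Set.mem_Icc, Pi.le_def] at h
    exact ⟨h.1 0, h.2 0⟩
  obtain ⟨m₁, m₂, hI, hvol⟩ := DimOne.exists_filter_eq_Icc hSoc hSN
  have hvol0 : 0 ≤ (volume S).toReal := ENNReal.toReal_nonneg
  have harch : archFactor Ψ K = (volume S).toReal := archFactor_eq_volume Ψ K
  have hcellI : (cell Ψ K N u (fun _ => i + 1) : ℝ) = #((Finset.Icc m₁ m₂).filter (fun m =>
      z < (Nat.minFac (a * m + b).toNat : ℝ) ∧ Ω (a * m + b).toNat = i + 1)) := by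
    rw [cell_eq_card_filter, ← hI, Finset.filter_filter]
    congr 2
    refine Finset.filter_congr fun m _ => ?_
    simp only [hSdef, Set.mem_setOf_eq]
    constructor
    · rintro ⟨hK', hlt, hΩ⟩
      refine ⟨⟨hK', ?_⟩, hlt, hΩ⟩
      by_contra hle
      push Not at hle
      have hle' : a * m + b ≤ 0 := by exact_mod_cast hle
      rw [Int.toNat_of_nonpos hle', Nat.minFac_zero, Nat.cast_ofNat] at hlt
      have hlt' : (N : ℝ) ^ ((1 : ℝ) / u) < 2 := hlt
      rw [← hz] at hlt'
      linarith
    · rintro ⟨⟨hK', -⟩, hlt, hΩ⟩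
      exact ⟨hK', hlt, hΩ⟩
  have hmemI : ∀ m : ℤ, m ∈ Finset.Icc m₁ m₂ → 0 < a * m + b ∧ (-(N : ℤ) ≤ m ∧ m ≤ N) := by
    intro m hm
    rw [← hI, Finset.mem_filter, Finset.mem_Icc] at hm
    have h := hm.2.2
    exact ⟨by exact_mod_cast h, hm.1⟩
  rw [hcellI, harch, hS]
  -- Case 2a: no integer point
  rcases lt_or_ge m₂ m₁ with hemp | hm12
  · rw [Finset.Icc_eq_empty_of_lt hemp, Finset.filter_empty, Finset.card_empty, Nat.cast_zero,
      zero_sub, abs_neg]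
    rw [Finset.Icc_eq_empty_of_lt hemp, Finset.card_empty, Nat.cast_zero, zero_sub, abs_neg] at hvol
    have hv1 : (volume S).toReal ≤ 1 := (le_abs_self _).trans hvol
    rw [abs_of_nonneg (by positivity)]
    calc (volume S).toReal * ((a.natAbs : ℝ) / Nat.totient a.natAbs) * (A / N) ≤ 1 * L * 1 := by
          gcongr
      _ ≤ R := by linarith
  -- Case 2b: the segment law for the sign-normalised progression
  have hcard : (#(Finset.Icc m₁ m₂) : ℝ) = (m₂ : ℝ) - m₁ + 1 := by
    have e : (((m₂ + 1 - m₁).toNat : ℕ) : ℝ) = ((m₂ + 1 - m₁ : ℤ) : ℝ) := by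
      exact_mod_cast Int.toNat_of_nonneg (by omega)
    rw [Int.card_Icc, e]; push_cast; ring
  rw [hcard] at hvol
  have hfin : ∀ (a' m₁' m₂' : ℤ), 0 < a' → a'.natAbs = a.natAbs → m₁' ≤ m₂' → Int.gcd a' b = 1 →
      0 < a' * m₁' + b → a' * m₂' + b ≤ L * N → (m₂' : ℝ) - m₁' = m₂ - m₁ →
      (#((Finset.Icc m₁ m₂).filter (fun m => z < (Nat.minFac (a * m + b).toNat : ℝ) ∧
          Ω (a * m + b).toNat = i + 1)) : ℝ) =
        #((Finset.Icc m₁' m₂').filter (fun m => z < (Nat.minFac (a' * m + b).toNat : ℝ) ∧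
          Ω (a' * m + b).toNat = i + 1)) →
      |(#((Finset.Icc m₁ m₂).filter (fun m => z < (Nat.minFac (a * m + b).toNat : ℝ) ∧
          Ω (a * m + b).toNat = i + 1)) : ℝ) -
        (volume S).toReal * ((a.natAbs : ℝ) / Nat.totient a.natAbs) * (A / N)| ≤ R := by
    intro a' m₁' m₂' ha' hnat hm' hgcd' hpos' hV' hlen hcount
    have hq : a'.toNat = a.natAbs := by
      rw [← hnat]
      exact Int.natCast_inj.mp (by rw [Int.toNat_of_nonneg ha'.le, Int.natAbs_of_nonneg ha'.le])
    have h := RoughCellsSegment.abs_card_segment_sub_le (u := u) (i := i) (E := E) ha' hm' hpos' hV'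
      hgcd' (hq ▸ haL) hlocN
    rw [← hcount, hq, hlen] at h
    simp only [← hz] at h
    -- from `q (m₂ − m₁ + 1)` to `q · vol S`
    set q : ℝ := (a.natAbs : ℝ) with hqdef
    set φq : ℝ := (Nat.totient a.natAbs : ℝ) with hφq
    have hφ0 : 0 < φq := by linarith
    have e : (#((Finset.Icc m₁ m₂).filter (fun m => z < (Nat.minFac (a * m + b).toNat : ℝ) ∧
          Ω (a * m + b).toNat = i + 1)) : ℝ) - (volume S).toReal * (q / φq) * (A / N) =
        ((#((Finset.Icc m₁ m₂).filter (fun m => z < (Nat.minFac (a * m + b).toNat : ℝ) ∧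
          Ω (a * m + b).toNat = i + 1)) : ℝ) - q * ((m₂ : ℝ) - m₁ + 1) / φq * (A / N)) +
        (q / φq) * (A / N) * (((m₂ : ℝ) - m₁ + 1) - (volume S).toReal) := by ring
    rw [e]
    refine (abs_add_le _ _).trans ?_
    have h2 : |(q / φq) * (A / N) * (((m₂ : ℝ) - m₁ + 1) - (volume S).toReal)| ≤ L := by
      rw [abs_mul, abs_of_nonneg (by positivity)]
      calc q / φq * (A / N) * |((m₂ : ℝ) - m₁ + 1) - (volume S).toReal| ≤ L * 1 * 1 :=
            mul_le_mul (mul_le_mul hqφ hA1 hA0 hL0) hvol (abs_nonneg _) (by positivity)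
        _ = L := by ring
    linarith [h2, h]
  rcases lt_or_gt_of_ne ha0 with hneg | hpos
  · -- `a < 0`: reflect `m ↦ -m`
    refine hfin (-a) (-m₂) (-m₁) (by omega) (Int.natAbs_neg a) (by omega) (by rwa [Int.neg_gcd])
      ?_ ?_ (by push_cast; ring) ?_
    · have := (hmemI m₂ (Finset.mem_Icc.mpr ⟨hm12, le_rfl⟩)).1; linarith
    · have h := value_le (hmemI m₁ (Finset.mem_Icc.mpr ⟨le_rfl, hm12⟩)).2 habL
      linarith
    · exact_mod_cast DimOne.card_filter_Icc_neg a b m₁ m₂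
        (fun v => z < (Nat.minFac v.toNat : ℝ) ∧ Ω v.toNat = i + 1)
  · exact hfin a m₁ m₂ hpos rfl hm12 hg (hmemI m₁ (Finset.mem_Icc.mpr ⟨le_rfl, hm12⟩)).1
      (value_le (hmemI m₂ (Finset.mem_Icc.mpr ⟨hm12, le_rfl⟩)).2 habL) rfl rfl

namespace BaseSavAux

/-! ## Numerics of the schedule -/

/-- **The constant of the explicit local law is `(log N)^{o(1)}` along the schedule.** For `A₁, A₃ ≥ 1`
and `L` there is `U₀` such that for all `U ≥ U₀`: `L ≤ U` and
`2 · K(U) · (2U + 2)² ≤ exp(2U²)`, `K(U) = 2A₃^{U+1}LU² + 2(2A₁^{2U+1}LU² + 12UL + L + 1)`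
(for `U ≥ A₃, A₁²`: `A₃^{U+1} ≤ U^{U+1}`, `A₁^{2U+1} ≤ A₁ U^U`, so the left side is `≤ c U^{U+5}`, and
`c U^{U+5} ≤ exp(2U²)` eventually by `quantClip_powSelf_le_exp`). Used with `log log N ≤ (2U+2)²`,
`exp(4U²) ≤ log N`: then `2 K(U) log log N ≤ (log N)^{1/2}`. -/
theorem schedule_numerics {A₁ A₃ : ℝ} (hA₁ : 1 ≤ A₁) (hA₃ : 1 ≤ A₃) (L : ℕ) :
    ∃ U₀ : ℕ, ∀ U : ℕ, U₀ ≤ U → L ≤ U ∧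
      2 * (2 * A₃ ^ (U + 1) * L * (U : ℝ) ^ 2 +
          2 * (2 * A₁ ^ (2 * U + 1) * L * (U : ℝ) ^ 2 + 12 * U * L + L + 1)) * (2 * (U : ℝ) + 2) ^ 2 ≤
        Real.exp (2 * (U : ℝ) ^ 2) := by
  obtain ⟨c, hc⟩ : ∃ c : ℝ, c = 64 * L + 128 * A₁ * L + 768 * L + 64 * L + 64 := ⟨_, rfl⟩
  obtain ⟨U₁, hU₁⟩ := quantClip_powSelf_le_exp (δ := 2) two_pos 5 c
  refine ⟨max (max U₁ L) (max ⌈A₃⌉₊ ⌈A₁ ^ 2⌉₊) + 1, fun U hU => ?_⟩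
  have hU₁U : U₁ ≤ U := by omega
  have hLU : L ≤ U := by omega
  have hA₃U : A₃ ≤ U := le_trans (Nat.le_ceil A₃) (by exact_mod_cast (by omega : ⌈A₃⌉₊ ≤ U))
  have hA₁U : A₁ ^ 2 ≤ U := le_trans (Nat.le_ceil (A₁ ^ 2)) (by exact_mod_cast (by omega : ⌈A₁ ^ 2⌉₊ ≤ U))
  have hU1 : (1 : ℝ) ≤ U := by exact_mod_cast (show 1 ≤ U by omega)
  refine ⟨hLU, le_trans ?_ (hU₁ U hU₁U)⟩
  set u : ℝ := (U : ℝ) with hu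
  have hL0 : (0 : ℝ) ≤ L := Nat.cast_nonneg L
  have hA₁0 : 0 ≤ A₁ := by linarith
  have hA₃0 : 0 ≤ A₃ := by linarith
  have hu0 : 0 ≤ u := by linarith
  -- monomial bounds against `P = u^{U+5}`
  set P : ℝ := u ^ (U + 5) with hP
  have hpow : ∀ k : ℕ, k ≤ U + 5 → u ^ k ≤ P := fun k hk => pow_le_pow_right₀ hU1 hk
  have h1 : A₃ ^ (U + 1) * u ^ 4 ≤ P := by
    calc A₃ ^ (U + 1) * u ^ 4 ≤ u ^ (U + 1) * u ^ 4 :=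
          mul_le_mul_of_nonneg_right (pow_le_pow_left₀ hA₃0 hA₃U _) (by positivity)
      _ = P := by rw [hP, ← pow_add]
  have h2 : A₁ ^ (2 * U + 1) * u ^ 4 ≤ A₁ * P := by
    have e : A₁ ^ (2 * U + 1) = (A₁ ^ 2) ^ U * A₁ := by rw [pow_succ, pow_mul]
    calc A₁ ^ (2 * U + 1) * u ^ 4 = A₁ * ((A₁ ^ 2) ^ U * u ^ 4) := by rw [e]; ring
      _ ≤ A₁ * (u ^ U * u ^ 4) := by
          refine mul_le_mul_of_nonneg_left ?_ hA₁0
          exact mul_le_mul_of_nonneg_right (pow_le_pow_left₀ (by positivity) hA₁U _) (by positivity)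
      _ = A₁ * u ^ (U + 4) := by rw [← pow_add]
      _ ≤ A₁ * P := mul_le_mul_of_nonneg_left (hpow _ (by omega)) hA₁0
  have h3 : u ^ 3 ≤ P := hpow 3 (by omega)
  have h4 : u ^ 2 ≤ P := hpow 2 (by omega)
  have hsq : (2 * u + 2) ^ 2 ≤ 16 * u ^ 2 := by nlinarith
  have hK0 : 0 ≤ 2 * (2 * A₃ ^ (U + 1) * L * u ^ 2 +
      2 * (2 * A₁ ^ (2 * U + 1) * L * u ^ 2 + 12 * u * L + L + 1)) := by positivity
  calc 2 * (2 * A₃ ^ (U + 1) * L * u ^ 2 +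
          2 * (2 * A₁ ^ (2 * U + 1) * L * u ^ 2 + 12 * u * L + L + 1)) * (2 * u + 2) ^ 2
      ≤ 2 * (2 * A₃ ^ (U + 1) * L * u ^ 2 +
          2 * (2 * A₁ ^ (2 * U + 1) * L * u ^ 2 + 12 * u * L + L + 1)) * (16 * u ^ 2) :=
        mul_le_mul_of_nonneg_left hsq hK0
    _ = 64 * L * (A₃ ^ (U + 1) * u ^ 4) + 128 * L * (A₁ ^ (2 * U + 1) * u ^ 4) +
          768 * L * u ^ 3 + 64 * L * u ^ 2 + 64 * u ^ 2 := by ring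
    _ ≤ 64 * L * P + 128 * L * (A₁ * P) + 768 * L * P + 64 * L * P + 64 * P := by
        gcongr
    _ = c * u ^ (U + 5) := by rw [hc, hP]; ring

/-- **The thresholds of the explicit local law along the schedule.** If `L ≥ 1`, `4 ≤ U`, `L ≤ U`,
`16 ≤ N`, `exp(4U²) ≤ log N` and `2N^{1/2} + 2 ≤ N/log² N`, then: `log log N ≥ 1`, `log L ≤ log log N`,
`2L + 2 ≤ N^{1/U}` (so `L, e < N^{1/U}`), `2N^{1/U} + 2 ≤ N/log² N`, `(log N)^{1/2} · (log N)^{1/2} = log N`,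
`exp(2U²) ≤ (log N)^{1/2}` and `4L ≤ N/log² N` (`N^{1/U} = exp(log N/U) ≥ 1 + log N/U ≥ 1 + 4U`, as
`log N ≥ exp(4U²) ≥ 4U² + 1`; and `N^{1/U} ≤ N^{1/2}`). -/
theorem schedule_thresholds {L U N : ℕ} (hL : 1 ≤ L) (hU4 : 4 ≤ U) (hLU : L ≤ U) (hN16 : 16 ≤ N)
    (hexpU : Real.exp (4 * (U : ℝ) ^ 2) ≤ Real.log N)
    (hzN2 : 2 * (N : ℝ) ^ ((1 : ℝ) / 2) + 2 ≤ N / Real.log N ^ 2) :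
    1 ≤ Real.log (Real.log N) ∧ Real.log L ≤ Real.log (Real.log N) ∧
    (2 * L + 2 : ℝ) ≤ (N : ℝ) ^ ((1 : ℝ) / U) ∧ (L : ℝ) < (N : ℝ) ^ ((1 : ℝ) / U) ∧
    Real.exp 1 < (N : ℝ) ^ ((1 : ℝ) / U) ∧ 2 * (N : ℝ) ^ ((1 : ℝ) / U) + 2 ≤ N / Real.log N ^ 2 ∧
    Real.log N ^ (1 / 2 : ℝ) * Real.log N ^ (1 / 2 : ℝ) = Real.log N ∧
    Real.exp (2 * (U : ℝ) ^ 2) ≤ Real.log N ^ (1 / 2 : ℝ) ∧ (4 * L : ℝ) ≤ N / Real.log N ^ 2 := by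
  have hU4R : (4 : ℝ) ≤ U := by exact_mod_cast hU4
  have hUpos : (0 : ℝ) < U := by linarith
  have hLUR : (L : ℝ) ≤ U := by exact_mod_cast hLU
  have hL1 : (1 : ℝ) ≤ L := by exact_mod_cast hL
  have hN1R : (1 : ℝ) < N := by exact_mod_cast (by omega : 1 < N)
  have hN0 : (0 : ℝ) < N := by linarith
  have h4U2 : 4 * (U : ℝ) ^ 2 + 1 ≤ Real.log N := le_trans (Real.add_one_le_exp _) hexpU
  have hlN0 : 0 < Real.log N := by nlinarith
  have hll4 : 4 * (U : ℝ) ^ 2 ≤ Real.log (Real.log N) := by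
    rw [Real.le_log_iff_exp_le hlN0]; exact hexpU
  -- `z = N^{1/U} = exp(log N/U) ≥ 1 + 4U`
  have hz_exp : (N : ℝ) ^ ((1 : ℝ) / U) = Real.exp (Real.log N / U) := by
    rw [Real.rpow_def_of_pos hN0]; congr 1; ring
  have hlNU : 4 * (U : ℝ) ≤ Real.log N / U := by
    rw [le_div_iff₀ hUpos]; nlinarith
  have hz4U : 1 + 4 * (U : ℝ) ≤ (N : ℝ) ^ ((1 : ℝ) / U) := by
    rw [hz_exp]
    calc 1 + 4 * (U : ℝ) ≤ Real.log N / U + 1 := by linarith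
      _ ≤ Real.exp (Real.log N / U) := Real.add_one_le_exp _
  have hLz2 : (2 * L + 2 : ℝ) ≤ (N : ℝ) ^ ((1 : ℝ) / U) := by linarith
  -- `z ≤ N^{1/2}`
  have hzhalf : (N : ℝ) ^ ((1 : ℝ) / U) ≤ (N : ℝ) ^ ((1 : ℝ) / 2) := by
    refine Real.rpow_le_rpow_of_exponent_le hN1R.le ?_
    rw [div_le_div_iff_of_pos_left one_pos hUpos two_pos]
    linarith
  -- `s = (log N)^{1/2}`
  have hs_sqrt : Real.log N ^ (1 / 2 : ℝ) = Real.sqrt (Real.log N) := by rw [Real.sqrt_eq_rpow]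
  have hexp2 : Real.exp (2 * (U : ℝ) ^ 2) ≤ Real.log N ^ (1 / 2 : ℝ) := by
    have h1 : Real.exp (4 * (U : ℝ) ^ 2) = Real.exp (2 * (U : ℝ) ^ 2) ^ 2 := by
      rw [← Real.exp_nat_mul]; congr 1; push_cast; ring
    rw [hs_sqrt]
    calc Real.exp (2 * (U : ℝ) ^ 2) = Real.sqrt (Real.exp (2 * (U : ℝ) ^ 2) ^ 2) :=
          (Real.sqrt_sq (Real.exp_pos _).le).symm
      _ ≤ Real.sqrt (Real.log N) := Real.sqrt_le_sqrt (by rw [← h1]; exact hexpU)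
  refine ⟨by nlinarith, ?_, hLz2, by linarith, ?_, by linarith, ?_, hexp2, by linarith⟩
  · have h1 : Real.log L ≤ L := (Real.log_le_sub_one_of_pos (by linarith)).trans (by linarith)
    nlinarith
  · have := Real.exp_one_lt_d9; linarith
  · rw [hs_sqrt, Real.mul_self_sqrt hlN0.le]

/-- **The error budget** (real arithmetic): from `2K · llN ≤ s`, `s ≥ 1`, `s² = lN ≥ 1`, `N > 0` and
`4L ≤ N/lN²`, the local-law error plus the segment cost is within the saving:
`K N llN/lN² + 2L ≤ N/(lN · s)` (`= s N/lN²`). -/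
theorem budget {K lN llN N L s : ℝ} (hN : 0 < N) (hlN : 1 ≤ lN) (hs1 : 1 ≤ s) (hss : s * s = lN)
    (hK : 2 * K * llN ≤ s) (h4L : 4 * L ≤ N / lN ^ 2) :
    K * N * llN / lN ^ 2 + 2 * L ≤ N / (lN ^ 1 * s) := by
  have hlN0 : 0 < lN := by linarith
  have hs0 : 0 < s := by linarith
  have hR : N / (lN ^ 1 * s) = s * N / lN ^ 2 := by
    rw [pow_one, div_eq_div_iff (by positivity) (by positivity), ← hss]
    ring
  rw [hR]
  have h1 : 2 * (K * N * llN / lN ^ 2) ≤ s * N / lN ^ 2 := by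
    rw [← mul_div_assoc, div_le_div_iff_of_pos_right (by positivity)]
    calc 2 * (K * N * llN) = (2 * K * llN) * N := by ring
      _ ≤ s * N := mul_le_mul_of_nonneg_right hK hN.le
  have h2 : N / lN ^ 2 ≤ s * N / lN ^ 2 := by
    rw [div_le_div_iff_of_pos_right (by positivity)]
    exact le_mul_of_one_le_left hN.le hs1
  linarith

end BaseSavAux

end Summit.Parity.GeneralizedHardyLittlewood.Cruxes.CellParityLawSaving.SuperPolyBand

end
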